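import Summits.QuantumFields.BalabanUV.T4Continuum.Spine.NE3.FrameNormalisationOneLevel
import HarnessLib

/-!
# T⁴ programme, node NE3 — census R50 open half (M1), TENTH BRICK: the twisted accumulated frame is within `Σ_{j<k} ε_j` of the accumulated frame (97) — the per-level frame
# errors ADD through the tower (`FrameNormalisationTowerError`)

Cell `pub-balaban-gaps` (track G2, seat ne3, generation 11), row NE3; census `HOME/ne/NE3.md` §4 R50, §17 (M1).  In the twisted tower of `FrameNormalisationTower` ∕ `…TowerExists` the
twisted accumulated frame obeys `𝔳_{j+1}(z) = 𝔳_j(Lz)·w′ʲ(Lz)`, while the accumulated frame (97) of the exact tower obeys `v_{j+1}(U′)(z) = v_j(U′)(Lz)·w[Ū₀ʲ](U̿′ʲ)(Lz)`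
(`B7Eq92Concrete.vcov_succ`).  The SELF-MAP estimate of the (M1) contraction (census §17 recipe (ii)) needs `‖𝔳_k − v_k(U′)‖`; this module reduces it to the per-level frame errors
`ε_j ≥ sup_y ‖w′ʲ(y) − w[Ū₀ʲ](U̿′ʲ)(y)‖` (which bricks 2 and 8 bound by the twist `η_j` and the tower displacement `‖Dʲ − U̿′ʲ‖`):

* **`norm_twistedVcov_sub_vcov_le`** — if the twisted frames have norm `≤ 1` (unitary) and the exact accumulated frames have norm `≤ 1` (unitary, [B8] Prop. 7's tower
  `FrameNormalisationAdmissibleTop.vcov_mem_unitaryUnits`), then for every `k` and `z`: **`‖𝔳_k(z) − v_k(U′)(z)‖ ≤ Σ_{j<k} ε_j`** (telescoping: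
  `𝔳_jw′ʲ − v_jwʲ = (𝔳_j − v_j)w′ʲ + v_j(w′ʲ − wʲ)`).

HONEST FRAMING (page 1).  Elementary bookkeeping on OUR objects (0 def, 0 sorry); the per-level errors `ε_j`, the tower displacement recursion and the contraction are NOT done here;
nothing of Bałaban's asserted; **NE3 NOT proved**; `PairLandauGaugeB8Avg` and the covariant root NOT proved; spine PROVED 0∕9; finite T⁴ rung (B)+1 — NOT continuum YM on ℝ⁴, NOT
infinite volume, NOT mass gap, NOT `BetaPertH`, NOT Clay.  HONEST DEPENDENCY: continuum YM on T⁴ ⇐ BetaPertH ∧ nine spine estimates (0/9 proved); BetaPertH ⇐ (D1) ∧ (D4) ∧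
CAP+tail; G-an2-4 gates asym, D1 and NE2/3/4.  PLACEMENT: `Summits/QuantumFields/BalabanUV/T4Continuum/Spine/NE3/`; imports `FrameNormalisationOneLevel` only.

References: [Balaban1985Averaging] T. Bałaban, *Averaging operations for lattice gauge theories*, CMP 98 (1985) 17–51: (97) p. 32, (160)–(163) p. 42.
-/

set_option autoImplicit false

open scoped BigOperators Matrix Matrix.Norms.L2Operator
open NormedSpace

namespace Summit.QuantumFields.BalabanUV.T4Continuum.NE3.FrameNormalisationTowerError

open Literature.MathematicalPhysics.QuantumFieldTheory.Balaban1983to89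
open B7Prop1Explicit B7Prop2Explicit
open B7Eq92Concrete (wframe dbavgCovIter vcov vcov_zero vcov_succ)

noncomputable section

variable {d : ℕ} {n : Type*} [Fintype n] [DecidableEq n]

/-- **THE PER-LEVEL FRAME ERRORS ADD THROUGH THE TOWER**: for a twisted accumulated frame `𝔳` (`𝔳₀ = 1`, `𝔳_{j+1}(z) = 𝔳_j(Lz)·w′ʲ(Lz)`) with `‖w′ʲ‖ ≤ 1`, exact accumulated frames
of norm `≤ 1`, and per-level frame errors `‖w′ʲ(y) − w[Ū₀ʲ](U̿′ʲ)(y)‖ ≤ ε_j` (`j < k`): `‖𝔳_k(z) − v_k(U′)(z)‖ ≤ Σ_{j<k} ε_j`. [folklore] -/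
theorem norm_twistedVcov_sub_vcov_le [Nonempty n] (L : ℕ) (W U' : Site d → Fin d → (Matrix n n ℂ)ˣ) (w' 𝔳 : ℕ → Site d → (Matrix n n ℂ)ˣ) (ε : ℕ → ℝ)
    (h𝔳0 : ∀ z : Site d, 𝔳 0 z = 1) (h𝔳 : ∀ (j : ℕ) (z : Site d), 𝔳 (j + 1) z = 𝔳 j ((L : ℤ) • z) * w' j ((L : ℤ) • z))
    (hw1 : ∀ (j : ℕ) (y : Site d), ‖((w' j y : (Matrix n n ℂ)ˣ) : Matrix n n ℂ)‖ ≤ 1)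
    (hv1 : ∀ (j : ℕ) (z : Site d), ‖((vcov L W U' j z : (Matrix n n ℂ)ˣ) : Matrix n n ℂ)‖ ≤ 1)
    (hε : ∀ (j : ℕ) (y : Site d),
      ‖((w' j y : (Matrix n n ℂ)ˣ) : Matrix n n ℂ) - ((wframe L (avgIter L W j) (dbavgCovIter L W U' j) y : (Matrix n n ℂ)ˣ) : Matrix n n ℂ)‖ ≤ ε j) :
    ∀ (k : ℕ) (z : Site d), ‖((𝔳 k z : (Matrix n n ℂ)ˣ) : Matrix n n ℂ) - ((vcov L W U' k z : (Matrix n n ℂ)ˣ) : Matrix n n ℂ)‖ ≤ ∑ j ∈ Finset.range k, ε j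
  | 0, z => by simp [h𝔳0 z, vcov_zero]
  | k + 1, z => by
    have ih := norm_twistedVcov_sub_vcov_le L W U' w' 𝔳 ε h𝔳0 h𝔳 hw1 hv1 hε k ((L : ℤ) • z)
    rw [h𝔳, vcov_succ, Units.val_mul, Units.val_mul, Finset.sum_range_succ]
    -- `a·b − c·e = (a − c)·b + c·(b − e)`
    have hid : ((𝔳 k ((L : ℤ) • z) : (Matrix n n ℂ)ˣ) : Matrix n n ℂ) * ((w' k ((L : ℤ) • z) : (Matrix n n ℂ)ˣ) : Matrix n n ℂ)
          - ((vcov L W U' k ((L : ℤ) • z) : (Matrix n n ℂ)ˣ) : Matrix n n ℂ)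
            * ((wframe L (avgIter L W k) (dbavgCovIter L W U' k) ((L : ℤ) • z) : (Matrix n n ℂ)ˣ) : Matrix n n ℂ)
        = (((𝔳 k ((L : ℤ) • z) : (Matrix n n ℂ)ˣ) : Matrix n n ℂ) - ((vcov L W U' k ((L : ℤ) • z) : (Matrix n n ℂ)ˣ) : Matrix n n ℂ))
            * ((w' k ((L : ℤ) • z) : (Matrix n n ℂ)ˣ) : Matrix n n ℂ)
          + ((vcov L W U' k ((L : ℤ) • z) : (Matrix n n ℂ)ˣ) : Matrix n n ℂ)
            * (((w' k ((L : ℤ) • z) : (Matrix n n ℂ)ˣ) : Matrix n n ℂ)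
              - ((wframe L (avgIter L W k) (dbavgCovIter L W U' k) ((L : ℤ) • z) : (Matrix n n ℂ)ˣ) : Matrix n n ℂ)) := by
      noncomm_ring
    rw [hid]
    have hεk : 0 ≤ ε k := (norm_nonneg _).trans (hε k ((L : ℤ) • z))
    have hsum : 0 ≤ ∑ j ∈ Finset.range k, ε j := (norm_nonneg _).trans ih
    calc _ ≤ ‖(((𝔳 k ((L : ℤ) • z) : (Matrix n n ℂ)ˣ) : Matrix n n ℂ) - ((vcov L W U' k ((L : ℤ) • z) : (Matrix n n ℂ)ˣ) : Matrix n n ℂ))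
              * ((w' k ((L : ℤ) • z) : (Matrix n n ℂ)ˣ) : Matrix n n ℂ)‖
          + ‖((vcov L W U' k ((L : ℤ) • z) : (Matrix n n ℂ)ˣ) : Matrix n n ℂ)
              * (((w' k ((L : ℤ) • z) : (Matrix n n ℂ)ˣ) : Matrix n n ℂ)
                - ((wframe L (avgIter L W k) (dbavgCovIter L W U' k) ((L : ℤ) • z) : (Matrix n n ℂ)ˣ) : Matrix n n ℂ))‖ := norm_add_le _ _
      _ ≤ (∑ j ∈ Finset.range k, ε j) * 1 + 1 * ε k := by
          refine add_le_add ?_ ?_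
          · exact (norm_mul_le _ _).trans (mul_le_mul ih (hw1 k _) (norm_nonneg _) hsum)
          · exact (norm_mul_le _ _).trans (mul_le_mul (hv1 k _) (hε k _) (norm_nonneg _) zero_le_one)
      _ = ∑ j ∈ Finset.range k, ε j + ε k := by ring

end

end Summit.QuantumFields.BalabanUV.T4Continuum.NE3.FrameNormalisationTowerError
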